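/-
Copyright: rh-split cell (screw, bridge) gen 19, 2026-08-28.  Splitting search over kernel-typed
RH-equivalences.  A splitting `A ∧ B ⟹ RH` is CONDITIONAL bookkeeping unless `A` and `B` are both
proved; nothing here bears on the truth of RH.
-/
import Summits.RiemannHypothesis.RiemannHypothesis.Theorems.Splittings.ScrewLatticeContinuationA
import HarnessLib

/-!
# §24 «PRIME-CELL BLINDNESS» — the prime-side twin of the lattice wall (ζ-free kernel algebra)

`Ψ = zetaScrew` (Suzuki 2023 (1.1)) is DEFINED on the prime side:
`Ψ(t) = 4(e^{|t|/2} + e^{-|t|/2} - 2) - φ(t) - c₁|t| + (Hurwitz–Lerch part)`, with the prime sum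
`φ(t) = zetaScrewPrimeSum t = ∑_{1 ≤ n ≤ e^{|t|}} Λ(n) n^{-1/2} (|t| - log n)` (`zetaScrew_eq`).
For an arbitrary weight `w : ℕ → ℝ` put `φ_w(t) = ∑_{1 ≤ n ≤ e^{|t|}} w(n) n^{-1/2} (|t| - log n)`
(`primeSumW`; `φ_Λ = φ`, `primeSumW_vonMangoldt`) and `Ψ_w = Ψ + φ - φ_w` (`screwW`; `Ψ_Λ = Ψ`).

* (K1) MOMENT IDENTITY (`primeSumW_eq_moments`): `φ_w(t) = |t|·M₀(w,t) - M₁(w,t)` with the two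
  CUMULATIVE MOMENTS `M₀ = ∑_{n ≤ e^{|t|}} w(n)/√n`, `M₁ = ∑_{n ≤ e^{|t|}} w(n) log n/√n`: a sample
  `φ_w(s)` sees the weights only through two numbers.
* (K2) TENTS (`tent a b c β`): for integers `1 ≤ a < b < c` the three-point perturbation with
  weights `β(log c - log b)/(log c - log a)·√a` at `a`, `-β√b` at `b`, `β(log b - log a)/(log c - log a)·√c`
  at `c` has BOTH moments zero over `{a, b, c}`; consequently `φ_{tent}` vanishes identically outside
  the open window `(log a, log c)` (`primeSumW_tent_of_le_log`, `primeSumW_tent_of_log_le`), is the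
  piecewise-linear hat inside (`primeSumW_tent_of_mem_left/right`), and takes the value
  `β·B(a,b,c)`, `B = (log c - log b)(log b - log a)/(log c - log a) > 0`, at the apex `t = log b`
  (`primeSumW_tent_apex`, `bumpConst_pos`).
* (K3) BLINDNESS (`primeSumW_add_tent_eq_of_window`, `primeSumW_add_tent_lattice`,
  `screwW_add_tent_lattice`, `latticeCeilingW_add_tent_iff`): every sample set avoiding the window —
  in particular the lattice `hℕ` as soon as `e^{kh} ≤ a < c ≤ e^{(k+1)h}` — assigns the SAME samples
  to `w` and to `w + tent`; the lattice ceiling `CEIL(h)` of `Ψ_{Λ + tent}` is literally `CEIL(h)` of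
  `Ψ`; yet `Ψ_{Λ+tent}(log b) = Ψ(log b) - β·B(a,b,c)` (`screwW_add_tent_apex`).  The perturbed
  weights stay non-negative and prime-power-supported, and are pointwise `η`-close to `Λ` in relative
  size, under the explicit smallness hypotheses of `abs_tent_le_mul` / `add_tent_nonneg`.
* (K4) SUPERPOSITION (`tentBlock`, `primeSumW_tentBlock_left`): tents with common feet `a`, `c` and
  apexes `b ∈ S` add up; left of the block the deviation is EXACTLY
  `(|t| - log a)/(log c - log a) · ∑_{b ∈ S} β_b (log c - log b)`.  With `S` = the prime powers of a
  quarter-cell and `β_b = η Λ(b)/√b` this is `≍ η h² e^{t/2}` at the cell's log-midpoint (the prime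
  mass `∑_{e^t < n ≤ e^{t+h/4}} Λ(n)/√n ∼ (e^{h/8} - e^{-h/8})·… ≍ h e^{t/2}` is the prime number theorem,
  `Literature.NumberTheory.LFunctions.chebyshevPsi_isEquivalent_holds`; the asymptotic count is NOT
  typed here — every identity of this file is exact and unconditional).
* (K5) MATCHED FAMILIES (`tentFamily`, §7): finitely many tents with pairwise disjoint supports inside
  one cell superpose; the family is lattice-blind (`primeSumW_add_tentFamily_lattice`,
  `latticeCeilingW_add_tentFamily_iff`), stays in the class `|w - Λ| ≤ ηΛ` under per-tent smallness
  (`abs_tentFamily_le_mul`, `add_tentFamily_nonneg`), and left of the apexes its deviation is bounded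
  BELOW by `(|t| - A₁)(C₁ - M)/L · ∑ β_i` (`primeSumW_add_tentFamily_left_ge`) — the lower half of the
  fibre oscillation.
* (K6) THE PIN (§9, `abs_primeSumW_sub_le_of_samples_eq`, `abs_screwW_sub_zetaScrew_le_of_lattice`):
  conversely, two equal samples at heights `T₀ < T₁` and `|w - w₀| ≤ η w₀` force
  `|φ_w - φ_{w₀}| ≤ 2η (T₁ - T₀) · ∑_{e^{T₀} < n ≤ e^{T₁}} w₀(n)/√n` in between — the upper half, of the
  same order `η h · m₀(cell) ≍ η h² e^{t/2}`; without any samples the class alone gives `η φ(t) ≍ 4η e^{t/2}`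
  (§10, `abs_screwW_sub_zetaScrew_le_mul_primeSum`): the lattice data buy a constant factor `≍ h²/2`, no exponent.

Reading (card SPLIT-screw-bridge.md §24): one lattice step `CEIL(h)` sees the primes only through the
cell moments; inside the class of non-negative prime-power-supported weights which agree with `Λ` to
relative precision `η` the fibre over the lattice data of `Ψ` contains members deviating from `Ψ` by
`≍ η h² e^{t/2}` between the samples — of either sign (`β > 0` hollows a cell, `β < 0` fills it).  Hence
no inference «`CEIL(h)` ∧ (prime-side facts insensitive to `√n`-relative reweighting within cells)
⟹ sub-exponential growth of `Ψ`» exists; completing one lattice step to RH must use `√`-fine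
arithmetic of the primes (equivalently, by the explicit formula, the zero side).  This is the fibre
form of the INTERPOLATION WALL of rh-idea-6 L41 (chord defect `Δ² e^{t/2}/8`), with the matching
order `Δ² e^{t/2}`.

HONEST LABEL: kernel algebra about finite prime sums; an INSTRUMENT / barrier note for the screw
column, not a splitting; RH-free; toward RH: 0.  Nothing here bears on the truth of RH.
-/

set_option linter.dupNamespace false

namespace Summit.RiemannHypothesis.RiemannHypothesis.Theorems.Splittings.ScrewPrimeCellBlindness

open Literature.NumberTheory.LFunctions
open Summit.RiemannHypothesis.RiemannHypothesis.Theorems.Splittings.ScrewLatticeContinuation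
  (LatticeCeiling)

/-! ## 1. The generalised prime sum `φ_w` and its two cumulative moments -/

/-- `φ_w(t) = ∑_{1 ≤ n ≤ e^{|t|}} w(n) n^{-1/2} (|t| - log n)` — Suzuki's prime sum with `Λ` replaced by
an arbitrary weight `w`. -/
noncomputable def primeSumW (w : ℕ → ℝ) (t : ℝ) : ℝ :=
  ∑ n ∈ Finset.Icc 1 ⌊Real.exp |t|⌋₊, w n / Real.sqrt n * (|t| - Real.log n)

/-- Zeroth cumulative moment `M₀(w, t) = ∑_{1 ≤ n ≤ e^{|t|}} w(n)/√n`. -/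
noncomputable def moment0 (w : ℕ → ℝ) (t : ℝ) : ℝ :=
  ∑ n ∈ Finset.Icc 1 ⌊Real.exp |t|⌋₊, w n / Real.sqrt n

/-- First cumulative moment `M₁(w, t) = ∑_{1 ≤ n ≤ e^{|t|}} w(n) log n/√n`. -/
noncomputable def moment1 (w : ℕ → ℝ) (t : ℝ) : ℝ :=
  ∑ n ∈ Finset.Icc 1 ⌊Real.exp |t|⌋₊, w n / Real.sqrt n * Real.log n

/-- `φ_Λ = φ` (definitional). -/
theorem primeSumW_vonMangoldt (t : ℝ) :
    primeSumW (fun n ↦ ArithmeticFunction.vonMangoldt n) t = zetaScrewPrimeSum t := rfl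

/-- **(K1) moment identity**: `φ_w(t) = |t| M₀(w,t) - M₁(w,t)`. -/
theorem primeSumW_eq_moments (w : ℕ → ℝ) (t : ℝ) :
    primeSumW w t = |t| * moment0 w t - moment1 w t := by
  simp only [primeSumW, moment0, moment1, Finset.mul_sum, ← Finset.sum_sub_distrib]
  exact Finset.sum_congr rfl fun n _ ↦ by ring

/-- Two weights with the same two cumulative moments at height `t` have the same sample `φ_w(t)`. -/
theorem primeSumW_eq_of_moments_eq {w w' : ℕ → ℝ} {t : ℝ}
    (h0 : moment0 w t = moment0 w' t) (h1 : moment1 w t = moment1 w' t) :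
    primeSumW w t = primeSumW w' t := by
  rw [primeSumW_eq_moments, primeSumW_eq_moments, h0, h1]

/-- `φ_w` is even. -/
theorem primeSumW_neg (w : ℕ → ℝ) (t : ℝ) : primeSumW w (-t) = primeSumW w t := by
  simp only [primeSumW, abs_neg]

/-- `φ` is additive in the weight. -/
theorem primeSumW_add (w w' : ℕ → ℝ) (t : ℝ) :
    primeSumW (w + w') t = primeSumW w t + primeSumW w' t := by
  simp only [primeSumW, Pi.add_apply, ← Finset.sum_add_distrib]
  exact Finset.sum_congr rfl fun n _ ↦ by ring

/-- `φ` commutes with finite sums of weights. -/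
theorem primeSumW_finset_sum {ι : Type*} (s : Finset ι) (w : ι → ℕ → ℝ) (t : ℝ) :
    primeSumW (fun n ↦ ∑ i ∈ s, w i n) t = ∑ i ∈ s, primeSumW (w i) t := by
  simp only [primeSumW, Finset.sum_div, Finset.sum_mul]
  exact Finset.sum_comm

/-- For `1 ≤ a`, the integer `a` is counted at height `t` iff `log a ≤ |t|`. -/
theorem mem_Icc_floor_exp_iff {a : ℕ} (ha : 1 ≤ a) (t : ℝ) :
    a ∈ Finset.Icc 1 ⌊Real.exp |t|⌋₊ ↔ Real.log a ≤ |t| := by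
  have ha0 : (0 : ℝ) < a := by exact_mod_cast ha
  rw [Finset.mem_Icc, Nat.le_floor_iff (Real.exp_pos _).le, Real.log_le_iff_le_exp ha0]
  exact ⟨fun h ↦ h.2, fun h ↦ ⟨ha, h⟩⟩

/-! ## 2. Spikes and tents -/

/-- The weight `x·√a` placed at the single integer `a` (it contributes `x (|t| - log a)` to `φ` once
`a` is counted). -/
noncomputable def spike (a : ℕ) (x : ℝ) : ℕ → ℝ := fun n ↦ if n = a then x * Real.sqrt a else 0

/-- The spike's value at its own integer: `spike a x a = x·√a`. -/
theorem spike_apply_self (a : ℕ) (x : ℝ) : spike a x a = x * Real.sqrt a := if_pos rfl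

/-- The spike vanishes at every integer other than `a`. -/
theorem spike_apply_of_ne {a n : ℕ} (x : ℝ) (h : n ≠ a) : spike a x n = 0 := if_neg h

/-- `φ_{spike a x}(t) = x (|t| - log a)` if `log a ≤ |t|`, and `0` otherwise (`1 ≤ a`). -/
theorem primeSumW_spike {a : ℕ} (ha : 1 ≤ a) (x t : ℝ) :
    primeSumW (spike a x) t = if Real.log a ≤ |t| then x * (|t| - Real.log a) else 0 := by
  have ha0 : (0 : ℝ) < a := by exact_mod_cast ha
  have hsq : Real.sqrt a ≠ 0 := (Real.sqrt_pos.2 ha0).ne'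
  unfold primeSumW
  split_ifs with h
  · rw [Finset.sum_eq_single_of_mem a ((mem_Icc_floor_exp_iff ha t).2 h)]
    · rw [spike_apply_self, mul_div_assoc, div_self hsq, mul_one]
    · intro n _ hn
      rw [spike_apply_of_ne x hn, zero_div, zero_mul]
  · refine Finset.sum_eq_zero fun n hn ↦ ?_
    have hne : n ≠ a := fun h' ↦ h ((mem_Icc_floor_exp_iff ha t).1 (h' ▸ hn))
    rw [spike_apply_of_ne x hne, zero_div, zero_mul]

/-- The BUMP CONSTANT `B(a,b,c) = (log c - log b)(log b - log a)/(log c - log a)`. -/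
noncomputable def bumpConst (a b c : ℕ) : ℝ :=
  (Real.log c - Real.log b) * (Real.log b - Real.log a) / (Real.log c - Real.log a)

/-- `B(a,b,c) > 0` for integers `1 ≤ a < b < c`. -/
theorem bumpConst_pos {a b c : ℕ} (ha : 1 ≤ a) (hab : a < b) (hbc : b < c) : 0 < bumpConst a b c := by
  have ha0 : (0 : ℝ) < a := by exact_mod_cast ha
  have hb0 : (0 : ℝ) < b := by exact_mod_cast (show 0 < b by omega)
  have hab' : Real.log a < Real.log b := Real.log_lt_log ha0 (by exact_mod_cast hab)
  have hbc' : Real.log b < Real.log c := Real.log_lt_log hb0 (by exact_mod_cast hbc)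
  unfold bumpConst
  exact div_pos (mul_pos (sub_pos.2 hbc') (sub_pos.2 hab')) (sub_pos.2 (hab'.trans hbc'))

/-- `B(a,b,c) ≤ (log c - log a)/4` (AM–GM): one tent inside a window of log-length `L` bumps by at most
`β L/4`. -/
theorem bumpConst_le {a b c : ℕ} (ha : 1 ≤ a) (hab : a < b) (hbc : b < c) :
    bumpConst a b c ≤ (Real.log c - Real.log a) / 4 := by
  have ha0 : (0 : ℝ) < a := by exact_mod_cast ha
  have hb0 : (0 : ℝ) < b := by exact_mod_cast (show 0 < b by omega)
  have hab' : Real.log a < Real.log b := Real.log_lt_log ha0 (by exact_mod_cast hab)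
  have hbc' : Real.log b < Real.log c := Real.log_lt_log hb0 (by exact_mod_cast hbc)
  have hL : 0 < Real.log c - Real.log a := sub_pos.2 (hab'.trans hbc')
  unfold bumpConst
  rw [div_le_div_iff₀ hL four_pos]
  nlinarith [sq_nonneg (Real.log c - Real.log b - (Real.log b - Real.log a))]

/-- The TENT perturbation on the integers `a < b < c`: weights `β(log c - log b)/(log c - log a)·√a` at `a`,
`-β√b` at `b`, `β(log b - log a)/(log c - log a)·√c` at `c`.  Both moments `∑ δ(n)/√n` and
`∑ δ(n) log n/√n` over `{a,b,c}` vanish. -/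
noncomputable def tent (a b c : ℕ) (β : ℝ) : ℕ → ℝ :=
  spike a (β * (Real.log c - Real.log b) / (Real.log c - Real.log a)) + spike b (-β)
    + spike c (β * (Real.log b - Real.log a) / (Real.log c - Real.log a))

/-- The tent is supported on `{a, b, c}`. -/
theorem tent_apply_of_ne {a b c n : ℕ} (β : ℝ) (hna : n ≠ a) (hnb : n ≠ b) (hnc : n ≠ c) :
    tent a b c β n = 0 := by
  simp only [tent, Pi.add_apply, spike_apply_of_ne _ hna, spike_apply_of_ne _ hnb,
    spike_apply_of_ne _ hnc, add_zero]

/-- The tent's weight at the left foot `a`: `β(log c - log b)/(log c - log a)·√a`. -/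
theorem tent_apply_a {a b c : ℕ} (hab : a < b) (hbc : b < c) (β : ℝ) :
    tent a b c β a = β * (Real.log c - Real.log b) / (Real.log c - Real.log a) * Real.sqrt a := by
  simp only [tent, Pi.add_apply, spike_apply_self, spike_apply_of_ne _ (show a ≠ b by omega),
    spike_apply_of_ne _ (show a ≠ c by omega), add_zero]

/-- The tent's weight at the apex `b`: `-β√b`. -/
theorem tent_apply_b {a b c : ℕ} (hab : a < b) (hbc : b < c) (β : ℝ) :
    tent a b c β b = -β * Real.sqrt b := by
  simp only [tent, Pi.add_apply, spike_apply_self, spike_apply_of_ne _ (show b ≠ a by omega),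
    spike_apply_of_ne _ (show b ≠ c by omega), zero_add, add_zero]

/-- The tent's weight at the right foot `c`: `β(log b - log a)/(log c - log a)·√c`. -/
theorem tent_apply_c {a b c : ℕ} (hab : a < b) (hbc : b < c) (β : ℝ) :
    tent a b c β c = β * (Real.log b - Real.log a) / (Real.log c - Real.log a) * Real.sqrt c := by
  simp only [tent, Pi.add_apply, spike_apply_self, spike_apply_of_ne _ (show c ≠ a by omega),
    spike_apply_of_ne _ (show c ≠ b by omega), zero_add]

/-- The full piecewise formula for `φ_{tent}`. -/
theorem primeSumW_tent {a b c : ℕ} (ha : 1 ≤ a) (hab : a < b) (hbc : b < c) (β t : ℝ) :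
    primeSumW (tent a b c β) t =
      (if Real.log a ≤ |t| then
          β * (Real.log c - Real.log b) / (Real.log c - Real.log a) * (|t| - Real.log a) else 0)
      + (if Real.log b ≤ |t| then -β * (|t| - Real.log b) else 0)
      + (if Real.log c ≤ |t| then
          β * (Real.log b - Real.log a) / (Real.log c - Real.log a) * (|t| - Real.log c) else 0) := by
  unfold tent
  rw [primeSumW_add, primeSumW_add, primeSumW_spike ha, primeSumW_spike (by omega),
    primeSumW_spike (by omega)]

/-- `log a < log b` for `1 ≤ a < b` (window bookkeeping). -/
private theorem log_a_lt_log_b {a b c : ℕ} (ha : 1 ≤ a) (hab : a < b) (_hbc : b < c) :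
    Real.log a < Real.log b :=
  Real.log_lt_log (by exact_mod_cast ha) (by exact_mod_cast hab)

/-- `log b < log c` for `1 ≤ a < b < c` (window bookkeeping). -/
private theorem log_b_lt_log_c {a b c : ℕ} (_ha : 1 ≤ a) (hab : a < b) (hbc : b < c) :
    Real.log b < Real.log c :=
  Real.log_lt_log (by exact_mod_cast (show 0 < b by omega)) (by exact_mod_cast hbc)

section regions

variable {a b c : ℕ} (ha : 1 ≤ a) (hab : a < b) (hbc : b < c) (β : ℝ)
include ha hab hbc

/-- LEFT of the window (`|t| ≤ log a`): `φ_{tent}(t) = 0`. -/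
theorem primeSumW_tent_of_le_log {t : ℝ} (ht : |t| ≤ Real.log a) : primeSumW (tent a b c β) t = 0 := by
  have h1 := log_a_lt_log_b ha hab hbc
  have h2 := log_b_lt_log_c ha hab hbc
  have hb : ¬ Real.log b ≤ |t| := by linarith
  have hc : ¬ Real.log c ≤ |t| := by linarith
  rw [primeSumW_tent ha hab hbc, if_neg hb, if_neg hc, add_zero, add_zero]
  split_ifs with h
  · rw [le_antisymm ht h, sub_self, mul_zero]
  · rfl

/-- RIGHT of the window (`log c ≤ |t|`): `φ_{tent}(t) = 0` — this is the vanishing of the two moments. -/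
theorem primeSumW_tent_of_log_le {t : ℝ} (ht : Real.log c ≤ |t|) : primeSumW (tent a b c β) t = 0 := by
  have h1 := log_a_lt_log_b ha hab hbc
  have h2 := log_b_lt_log_c ha hab hbc
  have hL : Real.log c - Real.log a ≠ 0 := by linarith
  rw [primeSumW_tent ha hab hbc, if_pos (by linarith), if_pos (by linarith), if_pos ht]
  field_simp
  ring

/-- RISING edge (`log a ≤ |t| ≤ log b`): `φ_{tent}(t) = β (log c - log b)/(log c - log a) · (|t| - log a)`. -/
theorem primeSumW_tent_of_mem_left {t : ℝ} (h1t : Real.log a ≤ |t|) (ht2 : |t| ≤ Real.log b) :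
    primeSumW (tent a b c β) t =
      β * (Real.log c - Real.log b) / (Real.log c - Real.log a) * (|t| - Real.log a) := by
  have h2 := log_b_lt_log_c ha hab hbc
  have hc : ¬ Real.log c ≤ |t| := by linarith
  rw [primeSumW_tent ha hab hbc, if_pos h1t, if_neg hc, add_zero]
  split_ifs with h
  · rw [le_antisymm ht2 h, sub_self, mul_zero, add_zero]
  · rw [add_zero]

/-- FALLING edge (`log b ≤ |t| ≤ log c`): `φ_{tent}(t) = β (log b - log a)/(log c - log a) · (log c - |t|)`. -/
theorem primeSumW_tent_of_mem_right {t : ℝ} (h1t : Real.log b ≤ |t|) (ht2 : |t| ≤ Real.log c) :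
    primeSumW (tent a b c β) t =
      β * (Real.log b - Real.log a) / (Real.log c - Real.log a) * (Real.log c - |t|) := by
  have h1 := log_a_lt_log_b ha hab hbc
  have h2 := log_b_lt_log_c ha hab hbc
  have hL : Real.log c - Real.log a ≠ 0 := by linarith
  rw [primeSumW_tent ha hab hbc, if_pos (by linarith), if_pos h1t]
  split_ifs with h
  · rw [le_antisymm ht2 h]
    field_simp
    ring
  · field_simp
    ring

/-- APEX: `φ_{tent}(log b) = β · B(a,b,c)`. -/
theorem primeSumW_tent_apex : primeSumW (tent a b c β) (Real.log b) = β * bumpConst a b c := by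
  have h1 := log_a_lt_log_b ha hab hbc
  have hb1 : (1 : ℝ) ≤ b := by exact_mod_cast (show 1 ≤ b by omega)
  have habs : |Real.log b| = Real.log b := abs_of_nonneg (Real.log_nonneg hb1)
  rw [primeSumW_tent_of_mem_left ha hab hbc β (by rw [habs]; exact h1.le) (by rw [habs]), habs,
    bumpConst]
  ring

/-- The tent sum has the sign of `β` everywhere: `0 ≤ β → 0 ≤ φ_{tent}(t)`. -/
theorem primeSumW_tent_nonneg (hβ : 0 ≤ β) (t : ℝ) : 0 ≤ primeSumW (tent a b c β) t := by
  have h1 := log_a_lt_log_b ha hab hbc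
  have h2 := log_b_lt_log_c ha hab hbc
  have hL : 0 < Real.log c - Real.log a := by linarith
  rcases le_or_gt |t| (Real.log a) with hta | hta
  · rw [primeSumW_tent_of_le_log ha hab hbc β hta]
  rcases le_or_gt |t| (Real.log b) with htb | htb
  · rw [primeSumW_tent_of_mem_left ha hab hbc β hta.le htb]
    exact mul_nonneg (div_nonneg (mul_nonneg hβ (by linarith)) hL.le) (by linarith)
  rcases le_or_gt |t| (Real.log c) with htc | htc
  · rw [primeSumW_tent_of_mem_right ha hab hbc β htb.le htc]
    exact mul_nonneg (div_nonneg (mul_nonneg hβ (by linarith)) hL.le) (by linarith)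
  · rw [primeSumW_tent_of_log_le ha hab hbc β htc.le]

/-- … and `|φ_{tent}(t)| ≤ |β| · B(a,b,c)`: the apex is the extreme value. -/
theorem abs_primeSumW_tent_le (t : ℝ) : |primeSumW (tent a b c β) t| ≤ |β| * bumpConst a b c := by
  have h1 := log_a_lt_log_b ha hab hbc
  have h2 := log_b_lt_log_c ha hab hbc
  have hL : 0 < Real.log c - Real.log a := by linarith
  have hB : 0 ≤ bumpConst a b c := (bumpConst_pos ha hab hbc).le
  rcases le_or_gt |t| (Real.log a) with hta | hta
  · rw [primeSumW_tent_of_le_log ha hab hbc β hta, abs_zero]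
    exact mul_nonneg (abs_nonneg β) hB
  rcases le_or_gt |t| (Real.log b) with htb | htb
  · rw [primeSumW_tent_of_mem_left ha hab hbc β hta.le htb,
      show β * (Real.log c - Real.log b) / (Real.log c - Real.log a) * (|t| - Real.log a) =
        β * ((Real.log c - Real.log b) * (|t| - Real.log a) / (Real.log c - Real.log a)) by ring,
      abs_mul]
    refine mul_le_mul_of_nonneg_left ?_ (abs_nonneg β)
    rw [abs_of_nonneg (div_nonneg (mul_nonneg (by linarith) (by linarith)) hL.le), bumpConst]
    exact div_le_div_of_nonneg_right (mul_le_mul_of_nonneg_left (by linarith) (by linarith)) hL.le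
  rcases le_or_gt |t| (Real.log c) with htc | htc
  · rw [primeSumW_tent_of_mem_right ha hab hbc β htb.le htc,
      show β * (Real.log b - Real.log a) / (Real.log c - Real.log a) * (Real.log c - |t|) =
        β * ((Real.log b - Real.log a) * (Real.log c - |t|) / (Real.log c - Real.log a)) by ring,
      abs_mul]
    refine mul_le_mul_of_nonneg_left ?_ (abs_nonneg β)
    rw [abs_of_nonneg (div_nonneg (mul_nonneg (by linarith) (by linarith)) hL.le), bumpConst]
    calc (Real.log b - Real.log a) * (Real.log c - |t|) / (Real.log c - Real.log a)
        ≤ (Real.log b - Real.log a) * (Real.log c - Real.log b) / (Real.log c - Real.log a) :=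
          div_le_div_of_nonneg_right (mul_le_mul_of_nonneg_left (by linarith) (by linarith)) hL.le
      _ = (Real.log c - Real.log b) * (Real.log b - Real.log a) / (Real.log c - Real.log a) := by
          ring
  · rw [primeSumW_tent_of_log_le ha hab hbc β htc.le, abs_zero]
    exact mul_nonneg (abs_nonneg β) hB

end regions

end Summit.RiemannHypothesis.RiemannHypothesis.Theorems.Splittings.ScrewPrimeCellBlindness
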